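import Literature.NumberTheory.Automorphic.PiOfArtinRepAtSigmaUnramifiedPlaces
import Literature.NumberTheory.Automorphic.StrongArtinGL2ArtinSideProofs
import HarnessLib

/-!
# Gelbart's Prop. 4.1 at the places where `σ` is unramified: local rigidity and the quotient of
the functional equations
(pure proofs; companion to `Automorphic/PiOfArtinRepAtSigmaUnramifiedPlaces`)

The named fact
`Literature.NumberTheory.Automorphic.frobSatakeCompatibleAt_of_isPiOfArtinRep_of_isUnramifiedAt`
(`PiOfArtinRepAtSigmaUnramifiedPlaces`; Gelbart, *Three lectures …* (1997), Prop. 4.1 with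
Thm. 3.2 and Example 3.2.3) says: if the cuspidal `π` of `GL₂(𝔸_F)` is `π(σ)` at almost every
place (`IsPiOfArtinRep σ π`), then at **every** finite place `v` at which the Artin representation
`σ` is unramified, `π` has a Satake parameter `α` with `∏_{a ∈ α} (X - a) = charpoly σ(Frob_v)`
(`FrobSatakeCompatibleAt σ π v`).  Gelbart gives no proof and refers to Langlands, *Base change for
GL(2)* (1980), pp. 23–24, i.e. to the argument concluding the proof of Jacquet–Langlands,
*Automorphic Forms on GL(2)*, LNM 114 (1970), Thm. 12.2 (pp. 209–211 of the retypeset edition):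
twist by an idèle class character `ω` with `ω_v = 1`, highly ramified at the other exceptional
places (Lemma 12.5); take the quotient of the functional equations of `L(s, ω ⊗ π)` (Thm. 11.1,
Cor. 11.2) and of `L(s, ω ⊗ σ)` (Artin); compare zeros and poles of the resulting one-place
identity (p. 211).

The sibling files `StrongArtinGL2LocalRigidityProofs` … `StrongArtinGL2ArtinSideProofs` formalise
this argument in the configuration of the companion fact `frobSatakeCompatibleAt_of_isPiOfArtinRep`
(at a place where **`π`** is unramified: known Satake parameter, unknown behaviour of `σ`).  This
file and `PiOfArtinRepAtSigmaUnramifiedPlacesArtinSideProofs` do the same in the configuration of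
the present fact — at a place where **`σ`** is unramified, so that the Artin Euler factor
`L_v(σ, T) = (1 - a₁ T)(1 - a₂ T)` is known (`aᵢ` roots of unity) while the local factor of `π` at
`v`, `L(s, π_v) = ∏_{b ∈ B} (1 - b q_v^{-s})⁻¹` with `card B ≤ 2` (Jacquet–Langlands Thm. 2.18,
Props. 3.5–3.6), is unknown.  Here: the local half and the quotient of the functional equations.

* `FramedArtinRep.exists_frobEigenvalues_of_isUnramifiedAt` — at an unramified place the
  Frobenius of `σ : Γ_F → GL₂(ℂ)` has a well-defined pair `A = {a₁, a₂}` of non-zero eigenvalues: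
  `charpoly σ(Frob_v) = ∏_{a ∈ A} (X - a)` (Serre 1968, Ch. I §2.1; Neukirch VII §10).
* `eq_frobEigenvalues_of_local_identity` — **local rigidity, `σ`-unramified configuration**
  (Jacquet–Langlands p. 211 mirrored): if off a closed set `E` meeting the zero sets of
  `1 - aᵢ q^{-s}` in finitely many points `Φ(s) ∏_{b ∈ B}(1 - b q^{-s}) = Ψ(s) L_v(σ, q^{-s})`
  with `Φ, Ψ` continuous off `E`, `Φ` non-vanishing off `E` and `card B ≤ 2`, then `B = A`.  This
  is the tree's `eq_pair_of_eulerTerm_identity` (rigidity of a single Euler factor); **no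
  condition on `B`** (nor on the dual local factor of `π`) is needed.
* `eq_frobEigenvalues_of_global_functional_equations` — **global ⇒ local** (pp. 209–210): from
  the four-function analytic package (the completed twisted L-functions of `π`, `σ` and their
  contragredients, holomorphic off a closed countable set, functional equations, Euler-factor
  agreement off `v`; `quotient_of_functional_equations`) the one-place identity and hence `B = A`.
  The exceptional set `E` consists of the zeros of `ε_π Γ_π(s) Γ_{σ'}(1 - s) L_v(σ', q^{-(1-s)})`
  (`σ'` the contragredient): the `Γ`-zeros lie on finitely many horizontal lines and the zeros of
  the dual Artin factor on the line `re s = 1`, while those of `1 - aᵢ q^{-s}` lie on `re s = 0`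
  (`|aᵢ| = 1`; `re_eq_zero_of_eulerTerm_eq_zero_of_norm_eq_one`,
  `eval_eulerFactorAt_one_sub_ne_zero`).

The Artin side of the package (instantiated from the tree's `artin_functional_equation_holds`),
the twist by `χ`, and the reduction of the named fact to its automorphic half are in
`PiOfArtinRepAtSigmaUnramifiedPlacesArtinSideProofs`.  No new definition and no named fact is
introduced (D-0026).

## References

* S. Gelbart, *Three lectures on the modularity of `ρ̄_{E,3}` and the Langlands reciprocity
  conjecture*, in *Modular Forms and Fermat's Last Theorem* (1997): Prop. 4.1 (p. 236 of the
  volume), Thm. 3.2, Example 3.2.3. [Gelbart1997]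
* H. Jacquet, R. P. Langlands, *Automorphic Forms on GL(2)*, LNM 114 (1970): Thm. 2.18,
  Props. 3.5, 3.6, Thm. 11.1, Cor. 11.2, Lemma 12.5, proof of Thm. 12.2 (pp. 209–211,
  retypeset ed.). [JacquetLanglands1970]
* R. P. Langlands, *Base Change for GL(2)*, Ann. of Math. Studies 96 (1980), §3, pp. 23–24.
  [LanglandsBaseChange1980]
* J.-P. Serre, *Abelian ℓ-adic representations and elliptic curves* (1968), Ch. I §2.1.
  [SerreAbelianLadic1968]
* J. Neukirch, *Algebraic Number Theory* (1999), VII §10 (10.1). [NeukirchANT1999]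
-/

noncomputable section

open scoped MatrixGroups NumberField Polynomial
open NumberField IsDedekindDomain Field Polynomial Complex Filter Topology Set
open Literature.NumberTheory.GaloisRepresentations (ArtinRep FramedArtinRep)
open Literature.NumberTheory.LFunctions

namespace Literature.NumberTheory.Automorphic

/-! ### Frobenius eigenvalues at an unramified place -/

section Eigenvalues

variable {F : Type} [Field F] [NumberField F]

/-- **The Frobenius eigenvalues of `σ : Γ_F → GL₂(ℂ)` at an unramified place.**  If `σ` is
unramified at `v` there is a multiset `A` of two non-zero complex numbers such that every
arithmetic Frobenius at every prime above `v` has characteristic polynomial `∏_{a ∈ A} (X - a)` on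
`σ`: take the roots (with multiplicity; `ℂ` is algebraically closed, Mathlib
`prod_multiset_X_sub_C_of_monic_of_roots_card_eq`) of `charpoly σ(g)` for one arithmetic Frobenius
`g` (which exists, `exists_isArithFrobAt_of_mem_primesAbove_holds`); all Frobenius elements above
`v` have the same characteristic polynomial (`GaloisRep.IsUnramifiedAt.hasFrobCharpolyAt_charpoly`,
Serre 1968, Ch. I §2.1), and the eigenvalues are roots of unity
(`norm_eq_one_of_mem_of_hasFrobCharpolyAt`), in particular non-zero.
[cite: SerreAbelianLadic1968, Ch. I §2.1] -/
theorem FramedArtinRep.exists_frobEigenvalues_of_isUnramifiedAt (σ : FramedArtinRep F 2)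
    {v : HeightOneSpectrum (𝓞 F)} (hur : σ.IsUnramifiedAt v) :
    ∃ A : Multiset ℂ, Multiset.card A = 2 ∧ (0 : ℂ) ∉ A ∧
      σ.HasFrobCharpolyAt v (satakePolynomial A) := by
  obtain ⟨𝔓, h𝔓⟩ := HeightOneSpectrum.primesAbove_nonempty v
  obtain ⟨g, hg⟩ := HeightOneSpectrum.exists_isArithFrobAt_of_mem_primesAbove_holds h𝔓
  set M : Matrix (Fin 2) (Fin 2) ℂ := ((σ g : GL (Fin 2) ℂ) : Matrix (Fin 2) (Fin 2) ℂ) with hM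
  have hsplit : ((M.charpoly).roots.map fun r => X - C r).prod = M.charpoly :=
    prod_multiset_X_sub_C_of_monic_of_roots_card_eq (Matrix.charpoly_monic M)
      (IsAlgClosed.card_roots_eq_natDegree (p := M.charpoly))
  have hcard : Multiset.card M.charpoly.roots = 2 := by
    rw [IsAlgClosed.card_roots_eq_natDegree (p := M.charpoly), Matrix.charpoly_natDegree_eq_dim,
      Fintype.card_fin]
  -- every Frobenius above `v` has this characteristic polynomial
  have hchar : σ.HasFrobCharpolyAt v (satakePolynomial M.charpoly.roots) := by
    have hQ : σ.toGaloisRep.HasFrobCharpolyAt v (σ.toGaloisRep g).charpoly :=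
      ((GaloisRepresentations.FramedGaloisRep.isUnramifiedAt_toGaloisRep_iff v σ).mpr
        hur).hasFrobCharpolyAt_charpoly h𝔓 hg
    rw [GaloisRepresentations.FramedGaloisRep.hasFrobCharpolyAt_toGaloisRep_iff] at hQ
    have hP : GaloisRepresentations.FramedRep.charpoly σ g = M.charpoly := rfl
    have hQg := hQ 𝔓 h𝔓 g hg
    -- `hQg : FramedRep.charpoly σ g = (σ.toGaloisRep g).charpoly`
    intro 𝔓' h𝔓' g' hg'
    rw [satakePolynomial, hsplit, ← hP, hQg]
    exact hQ 𝔓' h𝔓' g' hg'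
  refine ⟨M.charpoly.roots, hcard, fun h0 => ?_, hchar⟩
  have h1 := norm_eq_one_of_mem_of_hasFrobCharpolyAt σ hchar h0
  simp at h1

end Eigenvalues

/-! ### Local rigidity at a `σ`-unramified place (Jacquet–Langlands p. 211, mirrored) -/

section Local

variable {F : Type} [Field F] [NumberField F]

/-- **Local rigidity, `σ`-unramified configuration** (the zero-counting of Jacquet–Langlands
1970, proof of Thm. 12.2, p. 211, at a place where the *Artin* factor is known).  Let
`σ : Γ_F → GL₂(ℂ)` be unramified at `v` with Frobenius eigenvalues `A` (`card A = 2`,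
`charpoly σ(Frob_v) = ∏_{a ∈ A} (X - a)`), `q = N v`, and `B` a multiset with `card B ≤ 2` (the
inverse roots of `L(s, π_v)⁻¹`).  If off a closed set `E ⊆ ℂ` meeting the zero set of each
`1 - a q^{-s}`, `a ∈ A`, in finitely many points one has
`Φ(s) ∏_{b ∈ B} (1 - b q^{-s}) = Ψ(s) L_v(σ, q^{-s})` with `Φ, Ψ` continuous off `E` and `Φ`
non-vanishing off `E`, then `B = A`: `L_v(σ, T) = ∏_{a ∈ A} (1 - a T)`
(`eulerFactorAt_eq_eulerPolynomial_of_hasFrobCharpolyAt`), the `a ∈ A` are roots of unity, hence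
non-zero (`norm_eq_one_of_mem_of_hasFrobCharpolyAt`), and the rigidity of a single Euler factor
(`eq_pair_of_eulerTerm_identity`: at a zero of `1 - a₁ q^{-s}` off `E` some `1 - b q^{-s}`
vanishes, so `b = a₁`; cancel and repeat) applies.  Nothing is assumed about `B` beyond
`card B ≤ 2`. [cite: JacquetLanglands1970, proof of Thm. 12.2, p. 211] -/
theorem eq_frobEigenvalues_of_local_identity (σ : FramedArtinRep F 2)
    (v : HeightOneSpectrum (𝓞 F)) {A : Multiset ℂ} (hcard : Multiset.card A = 2)
    (hur : σ.IsUnramifiedAt v) (hchar : σ.HasFrobCharpolyAt v (satakePolynomial A))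
    {B : Multiset ℂ} (hB : Multiset.card B ≤ 2) {E : Set ℂ} (hEc : IsClosed E)
    (hEfin : ∀ a ∈ A, {s | s ∈ E ∧ eulerTerm v.residueCard a s = 0}.Finite)
    {Φ Ψ : ℂ → ℂ} (hΦc : ContinuousOn Φ Eᶜ) (hΨc : ContinuousOn Ψ Eᶜ)
    (hΦ : ∀ s, s ∉ E → Φ s ≠ 0)
    (hid : ∀ s, s ∉ E →
      Φ s * (B.map fun b => eulerTerm v.residueCard b s).prod =
        Ψ s * (σ.toArtinRep.eulerFactorAt v).eval ((v.residueCard : ℂ) ^ (-s))) :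
    B = A := by
  have hq : 1 < v.residueCard := v.one_lt_residueCard
  obtain ⟨a₁, a₂, rfl⟩ := Multiset.card_eq_two.mp hcard
  have ha₁ : a₁ ∈ ({a₁, a₂} : Multiset ℂ) := Multiset.mem_cons_self _ _
  have ha₂ : a₂ ∈ ({a₁, a₂} : Multiset ℂ) := by simp
  have hn0 : ∀ {a : ℂ}, a ∈ ({a₁, a₂} : Multiset ℂ) → a ≠ 0 := fun {a} ha h0 => by
    have h1 := norm_eq_one_of_mem_of_hasFrobCharpolyAt σ hchar ha
    rw [h0, norm_zero] at h1
    exact zero_ne_one h1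
  -- `L_v(σ, q^{-s}) = (1 - a₁ q^{-s})(1 - a₂ q^{-s})`
  have hL : ∀ s : ℂ, (σ.toArtinRep.eulerFactorAt v).eval ((v.residueCard : ℂ) ^ (-s)) =
      eulerTerm v.residueCard a₁ s * eulerTerm v.residueCard a₂ s := fun s => by
    rw [eulerFactorAt_eq_eulerPolynomial_of_hasFrobCharpolyAt σ hur hchar, eval_eulerPolynomial]
    simp [eulerTerm_def]
  exact eq_pair_of_eulerTerm_identity hq (hn0 ha₁) (hn0 ha₂) hB hEc (hEfin a₁ ha₁) (hEfin a₂ ha₂)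
    hΦc hΨc hΦ fun s hs => by rw [← hL s, ← hid s hs]

end Local

/-! ### Global ⇒ local at a `σ`-unramified place (Jacquet–Langlands pp. 209–210) -/

section Global

variable {F : Type} [Field F] [NumberField F]

/-- A zero of `1 - a q^{-s}` with `|a| = 1` (`q > 1`) lies on the line `re s = 0`
(`|a| = q^{re s}`, `norm_eq_rpow_of_eulerTerm_eq_zero`). [folklore] -/
theorem re_eq_zero_of_eulerTerm_eq_zero_of_norm_eq_one {q : ℕ} (hq : 1 < q) {a s : ℂ}
    (ha : ‖a‖ = 1) (hs : eulerTerm q a s = 0) : s.re = 0 := by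
  have hq' : (1 : ℝ) < q := Nat.one_lt_cast.mpr hq
  have h := norm_eq_rpow_of_eulerTerm_eq_zero (lt_trans zero_lt_one hq) hs
  rw [ha] at h
  rcases lt_trichotomy s.re 0 with hlt | heq | hgt
  · exact absurd h (ne_of_gt (Real.rpow_lt_one_of_one_lt_of_neg hq' hlt))
  · exact heq
  · exact absurd h (ne_of_lt (Real.one_lt_rpow hq' hgt))

/-- **The dual Artin factor does not interfere.**  At a zero `s` of `1 - a q^{-s}` with `|a| = 1`
(so `re s = 0`) the Euler factor `L_v(σ', q^{-(1-s)})` of any Artin representation `σ'` does not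
vanish: `L_v(σ', T) = ∏ (1 - c T)` with roots of unity `c`
(`ArtinRep.exists_card_le_eval_eulerFactorAt_eq_prod`), and `1 - c q^{-(1-s)} = 0` would force
`re (1 - s) = 0`.  In Jacquet–Langlands 1970, p. 211: the poles of `L(1 - s, ω_v⁻¹ ⊗ σ̃_v)` lie on
`re s = 1`, those of `L(s, ω_v ⊗ σ_v)` on `re s = 0`.
[cite: JacquetLanglands1970, proof of Thm. 12.2, p. 211] -/
theorem eval_eulerFactorAt_one_sub_ne_zero {n : ℕ} (σ' : FramedArtinRep F n)
    (v : HeightOneSpectrum (𝓞 F)) {a s : ℂ} (ha : ‖a‖ = 1) (hs : eulerTerm v.residueCard a s = 0) :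
    (σ'.toArtinRep.eulerFactorAt v).eval ((v.residueCard : ℂ) ^ (-(1 - s))) ≠ 0 := by
  have hq : 1 < v.residueCard := v.one_lt_residueCard
  obtain ⟨C, -, hC1, hC⟩ :=
    GaloisRepresentations.ArtinRep.exists_card_le_eval_eulerFactorAt_eq_prod σ'.toArtinRep
      (GaloisRepresentations.ArtinRep.finite_range_holds (K := F) (V := Fin n → ℂ) σ'.toArtinRep) v
  rw [hC]
  intro h0
  obtain ⟨c, hc, hc0⟩ := Multiset.mem_map.mp (Multiset.prod_eq_zero_iff.mp h0)
  have hc0' : eulerTerm v.residueCard c (1 - s) = 0 := by rw [eulerTerm_def]; exact hc0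
  have h1 := re_eq_zero_of_eulerTerm_eq_zero_of_norm_eq_one hq (hC1 c hc) hc0'
  have h2 := re_eq_zero_of_eulerTerm_eq_zero_of_norm_eq_one hq ha hs
  rw [sub_re, one_re, h2, sub_zero] at h1
  exact one_ne_zero h1

/-- **`L(s, π_v) = L(s, σ_v)` at a `σ`-unramified place from the quotient of the functional
equations** (Jacquet–Langlands 1970, proof of Thm. 12.2, pp. 209–211, assembled in the
configuration of Gelbart 1997, Prop. 4.1 at a place where `σ` is unramified).  Let
`σ : Γ_F → GL₂(ℂ)` be unramified at `v` with Frobenius eigenvalues `A`, `σ'` any Artin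
representation (the contragredient of `σ`), `q = N v`, `B` (`card B ≤ 2`) and `B'` multisets
(the inverse roots of `L(s, ω_v ⊗ π_v)⁻¹` and `L(s, ω_v⁻¹ ⊗ π̃_v)⁻¹`).  Suppose given the *global
analytic package at `v`*: a closed countable `P ⊆ ℂ` stable under `s ↦ 1 - s`;
`Λ_π, Λ_σ, Λ_π', Λ_σ'` holomorphic off `P` (`L(s, ω ⊗ π)`, `L(s, ω ⊗ σ)`, `L(s, ω⁻¹ ⊗ π̃)`,
`L(s, ω⁻¹ ⊗ σ̃)`, completed); entire `Γ_π, Γ_σ, Γ_π', Γ_σ'` (reciprocal archimedean factors; `Γ_π`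
and `Γ_σ'` vanishing only on finitely many horizontal lines); continuous `ε_π, ε_σ` with `ε_π`
nowhere zero; (i) for `re s > c`,
`Λ_π(s) ∏_{b ∈ B}(1 - b q^{-s}) Γ_π(s) = Λ_σ(s) L_v(σ, q^{-s}) Γ_σ(s)` and
`Λ_π'(s) ∏_{b ∈ B'}(1 - b q^{-s}) Γ_π'(s) = Λ_σ'(s) L_v(σ', q^{-s}) Γ_σ'(s)` (the Euler factors at
the places `≠ v, ∞` agree); (ii) `Λ_π(s) = ε_π(s) Λ_π'(1 - s)` and `Λ_σ(s) = ε_σ(s) Λ_σ'(1 - s)`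
off `P`; (iii) `Λ_π' ≢ 0` off `P`.  Then `B = A`, i.e. `L(s, ω_v ⊗ π_v) = L(s, ω_v ⊗ σ_v)`.
Proof: `quotient_of_functional_equations` yields
`Φ(s) ∏_{b ∈ B}(1 - b q^{-s}) = Ψ(s) L_v(σ, q^{-s})` for all `s`, with
`Φ = ε_π Γ_π · Γ_σ'(1 - ·) L_v(σ', q^{-(1 - ·)})` and
`Ψ = ε_σ Γ_σ · Γ_π'(1 - ·) ∏_{b ∈ B'}(1 - b q^{-(1-·)})`;
the zero set `E` of `Φ` meets the zeros of each `1 - a q^{-s}` (`a ∈ A`, `|a| = 1`, on `re s = 0`)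
in finitely many points (`Γ`-zeros on finitely many horizontal lines,
`finite_setOf_eulerTerm_eq_zero_and_im_mem`; dual Artin zeros on `re s = 1`,
`eval_eulerFactorAt_one_sub_ne_zero`); conclude by `eq_frobEigenvalues_of_local_identity`.  No
hypothesis on `B'`, `ε_σ`, `Γ_σ`, `Γ_π'` beyond continuity is needed.
[cite: JacquetLanglands1970, proof of Thm. 12.2, pp. 209–211] -/
theorem eq_frobEigenvalues_of_global_functional_equations (σ σ' : FramedArtinRep F 2)
    (v : HeightOneSpectrum (𝓞 F)) {A : Multiset ℂ} (hcard : Multiset.card A = 2)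
    (hur : σ.IsUnramifiedAt v) (hchar : σ.HasFrobCharpolyAt v (satakePolynomial A))
    {B B' : Multiset ℂ} (hB : Multiset.card B ≤ 2)
    {P : Set ℂ} (hPc : IsClosed P) (hP : P.Countable) (hPs : ∀ s ∈ P, 1 - s ∈ P)
    {Λπ Λσ Λπ' Λσ' : ℂ → ℂ} (hΛπ : DifferentiableOn ℂ Λπ Pᶜ) (hΛσ : DifferentiableOn ℂ Λσ Pᶜ)
    (hΛπ' : DifferentiableOn ℂ Λπ' Pᶜ) (hΛσ' : DifferentiableOn ℂ Λσ' Pᶜ)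
    {Γπ Γσ Γπ' Γσ' επ εσ : ℂ → ℂ} (hΓπ : Differentiable ℂ Γπ) (hΓσ : Differentiable ℂ Γσ)
    (hΓπ' : Differentiable ℂ Γπ') (hΓσ' : Differentiable ℂ Γσ') (hεπ : Continuous επ)
    (hεσ : Continuous εσ) (hεπ0 : ∀ s, επ s ≠ 0)
    (hYπ : ∃ Y : Set ℝ, Y.Finite ∧ ∀ s, Γπ s = 0 → s.im ∈ Y)
    (hYσ' : ∃ Y : Set ℝ, Y.Finite ∧ ∀ s, Γσ' s = 0 → s.im ∈ Y)
    {c : ℝ}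
    (hE : ∀ s, c < s.re → s ∉ P →
      Λπ s * ((B.map fun b => eulerTerm v.residueCard b s).prod * Γπ s) =
        Λσ s * ((σ.toArtinRep.eulerFactorAt v).eval ((v.residueCard : ℂ) ^ (-s)) * Γσ s))
    (hE' : ∀ s, c < s.re → s ∉ P →
      Λπ' s * ((B'.map fun b => eulerTerm v.residueCard b s).prod * Γπ' s) =
        Λσ' s * ((σ'.toArtinRep.eulerFactorAt v).eval ((v.residueCard : ℂ) ^ (-s)) * Γσ' s))
    (hFπ : ∀ s, s ∉ P → Λπ s = επ s * Λπ' (1 - s))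
    (hFσ : ∀ s, s ∉ P → Λσ s = εσ s * Λσ' (1 - s))
    (hNV : ∃ s, s ∉ P ∧ Λπ' s ≠ 0) :
    B = A := by
  have hq : 1 < v.residueCard := v.one_lt_residueCard
  have hq0 : v.residueCard ≠ 0 := by omega
  -- the local factors at `v` are entire
  have hPπ : Differentiable ℂ fun s : ℂ => (B.map fun b => eulerTerm v.residueCard b s).prod :=
    differentiable_multiset_prod_eulerTerm hq0 B
  have hPπ' : Differentiable ℂ fun s : ℂ => (B'.map fun b => eulerTerm v.residueCard b s).prod :=
    differentiable_multiset_prod_eulerTerm hq0 B'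
  have hcpow : Differentiable ℂ fun s : ℂ => (v.residueCard : ℂ) ^ (-s) :=
    differentiable_neg.const_cpow (Or.inl (Nat.cast_ne_zero.mpr hq0))
  have hPσ : Differentiable ℂ fun s : ℂ =>
      (σ.toArtinRep.eulerFactorAt v).eval ((v.residueCard : ℂ) ^ (-s)) :=
    (Polynomial.differentiable (σ.toArtinRep.eulerFactorAt v)).comp hcpow
  have hPσ' : Differentiable ℂ fun s : ℂ =>
      (σ'.toArtinRep.eulerFactorAt v).eval ((v.residueCard : ℂ) ^ (-s)) :=
    (Polynomial.differentiable (σ'.toArtinRep.eulerFactorAt v)).comp hcpow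
  -- the quotient of the functional equations (Jacquet–Langlands p. 209)
  have hid := quotient_of_functional_equations hPc hP hPs hΛπ hΛσ hΛπ' hΛσ' (hPπ.fun_mul hΓπ)
    (hPσ.fun_mul hΓσ) (hPπ'.fun_mul hΓπ') (hPσ'.fun_mul hΓσ') hεπ hεσ hE hE' hFπ hFσ hNV
  -- the cofactor `Φ` of `∏_{b ∈ B} (1 - b q^{-s})` and the cofactor `Ψ` of `L_v(σ, q^{-s})`
  obtain ⟨Yπ, hYπf, hYπ⟩ := hYπ
  obtain ⟨Yσ', hYσ'f, hYσ'⟩ := hYσ'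
  have h1s : Continuous fun s : ℂ => 1 - s := continuous_const.sub continuous_id
  have hΦc : Continuous fun s => επ s * Γπ s *
      ((σ'.toArtinRep.eulerFactorAt v).eval ((v.residueCard : ℂ) ^ (-(1 - s))) * Γσ' (1 - s)) :=
    (hεπ.mul hΓπ.continuous).mul ((hPσ'.continuous.comp h1s).mul (hΓσ'.continuous.comp h1s))
  have hΨc : Continuous fun s => εσ s * Γσ s *
      ((B'.map fun b => eulerTerm v.residueCard b (1 - s)).prod * Γπ' (1 - s)) :=
    (hεσ.mul hΓσ.continuous).mul ((hPπ'.continuous.comp h1s).mul (hΓπ'.continuous.comp h1s))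
  -- the zero set `E` of `Φ` meets the zeros of each `1 - a q^{-s}`, `a ∈ A`, finitely
  have hEfin : ∀ a ∈ A, {s | s ∈ {s : ℂ | επ s * Γπ s *
      ((σ'.toArtinRep.eulerFactorAt v).eval ((v.residueCard : ℂ) ^ (-(1 - s))) * Γσ' (1 - s)) = 0} ∧
        eulerTerm v.residueCard a s = 0}.Finite := by
    intro a ha
    have ha1 : ‖a‖ = 1 := norm_eq_one_of_mem_of_hasFrobCharpolyAt σ hchar ha
    refine (finite_setOf_eulerTerm_eq_zero_and_im_mem hq a
      (hYπf.union (hYσ'f.image fun y => -y))).subset ?_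
    rintro s ⟨hsΦ, hs0⟩
    refine ⟨hs0, ?_⟩
    rcases mul_eq_zero.mp hsΦ with h | h
    · rcases mul_eq_zero.mp h with h | h
      · exact absurd h (hεπ0 s)
      · exact Or.inl (hYπ s h)
    · rcases mul_eq_zero.mp h with h | h
      · exact absurd h (eval_eulerFactorAt_one_sub_ne_zero σ' v ha1 hs0)
      · exact Or.inr ⟨(1 - s).im, hYσ' _ h, by simp⟩
  refine eq_frobEigenvalues_of_local_identity σ v hcard hur hchar hB
    (isClosed_eq hΦc continuous_const) hEfin hΦc.continuousOn hΨc.continuousOn (fun s hs => hs)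
    fun s _ => ?_
  have h := hid s
  beta_reduce at h
  linear_combination h

end Global

end Literature.NumberTheory.Automorphic

end
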